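import Summits.QuantumFields.BalabanUV.Beta.FP.PerfectSymbol166
import Summits.QuantumFields.BalabanUV.Beta.FP.PerfectSymbolKMultiplier

/-!
# `BalabanUV.Beta.FP.PerfectSymbolKMultiplierClosed` — road «FP» (binder row D1), leaf N0b-K-closed, PART 3: the perfect Laplacian `Δ_∞` and the MULTIPLIER
# BLOCK of the perfect resolvent `KPerf … m` as lattice kernels of a CLOSED-FORM symbol (gan24-p3-g12's sub-row N0b-K-mm, completed to a closed form)

Road FP (owner b2b-balaban-beta-d1-p3, gen 2; ruling R-FP-12 «explicit = closed form»).  gan24-p3's `EffectiveLaplacianLimit` names the continuum (1.66) entry symbol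
`GsymLim μ ν a b p := ½ · W166lim μ ν p · (e^{−ip_a} − 1)(e^{ip_b} − 1)`, its lattice kernel `kerReLim` and the perfect effective Laplacian `deltaZLim = Δ_∞`, and
`FP/PerfectSymbolKMultiplier.KPerf_inr_inr_coarse` reads the (inr,inr) block of the perfect resolvent at coarse points as `(2/Lc^{8m})·Δ_∞`.  PART 2
(`FP/PerfectSymbol166.W166lim_eq_W166Inf`, p222342) identified `W166lim` with the explicit `ℤ^d` alias series `W166Inf` on the zero-free strip.  This part
substitutes: `GsymInf μ ν a b p := ½ · W166Inf μ ν p · (e^{−ip_a} − 1)(e^{ip_b} − 1)` (closed form), `GsymLim_eq_GsymInf` (on the strip), **`kerReLim_eq_closed`**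
(the perfect entry kernel IS the lattice kernel of the closed-form symbol — the Brillouin zone lies in `Strip _ 0`), **`deltaZLim_eq_closed`**,
**`KPerf_inr_inr_coarse_closed`** (the multiplier block of `KPerf … m`, every `m`, every `Lc ≥ 2`, as `(2/Lc^{8m})` × the bond combination of the lattice kernels
of `GsymInf`).  [our object]; 0 `def … : Prop`; nothing cited; no estimate.
HONEST FRAMING: bookkeeping toward the explicit perfect objects of road FP (`hident`, GAPS O-asym1-7); discharges nothing of `BetaPertH`; NOT the continuum limit,
NOT Clay.  HONEST DEPENDENCY (verbatim): «continuum YM on T⁴ ⇐ BetaPertH ∧ nine spine estimates (0/9 proved); BetaPertH ⇐ (D1) ∧ (D4) ∧ CAP+tail; G-an2-4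
gates asym, D1 and NE2/3/4.»
-/

noncomputable section

namespace Summit.QuantumFields.BalabanUV.Beta.FP.PerfectSymbolKMultiplierClosed

open MeasureTheory
open Literature.MathematicalPhysics.QuantumFieldTheory
open Literature.MathematicalPhysics.QuantumFieldTheory.Balaban1983to89
open Literature.MathematicalPhysics.QuantumFieldTheory.LatticeForm (quo)
open B4Strip (Strip ofRealVec)
open B4ContourShift (BZ integrand fourierBox latticeKernel ofRealVec_mem_Strip)
open B5Symbol166Strip (expFacNeg expFacPos kappa166 kappa166_pos)
open B4Sect5Exhaustion (K)
open T4Rate166StripDirect (W166lim)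
open Summit.QuantumFields.BalabanUV.Beta.GAN24.CombesThomas (sfStep smStep)
open Summit.QuantumFields.BalabanUV.Beta.GAN24.DirichletExhaustionDeltaZ (summand)
open Summit.QuantumFields.BalabanUV.Beta.GAN24.EffectiveLaplacianLimit (GsymLim kerReLim deltaZLim)
open Summit.QuantumFields.BalabanUV.Beta.FP.PerfectObjectsT (KPerf)
open Summit.QuantumFields.BalabanUV.Beta.FP.PerfectSymbol166 (W166Inf W166lim_eq_W166Inf)
open Summit.QuantumFields.BalabanUV.Beta.FP.PerfectSymbolKMultiplier (KPerf_inr_inr_coarse)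

variable {d : ℕ}

/-- [our object] **THE CONTINUUM (1.66) ENTRY SYMBOL IN CLOSED FORM**: `G^{ab}_{μν,∞}(p) := ½ · W_∞(μ,ν;p) · (e^{−ip_a} − 1)(e^{ip_b} − 1)` with PART 2's explicit
alias series `W166Inf` in place of the named limit `W166lim`. -/
def GsymInf (μ ν a b : Fin d) (p : Fin d → ℂ) : ℂ := 1 / 2 * W166Inf μ ν p * (expFacNeg a p * expFacPos b p)

/-- On the zero-free strip gan24-p3's `GsymLim` IS the closed form `GsymInf`. [our object] -/
theorem GsymLim_eq_GsymInf {κ : ℝ} (hκ0 : 0 ≤ κ) (hκ : κ ≤ kappa166 d) {p : Fin d → ℂ} (hp : p ∈ Strip d κ) (μ ν a b : Fin d) :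
    GsymLim μ ν a b p = GsymInf μ ν a b p := by
  unfold GsymLim GsymInf
  rw [W166lim_eq_W166Inf hκ0 hκ hp]

/-- **THE PERFECT (1.66) ENTRY KERNEL IS THE LATTICE KERNEL OF THE CLOSED-FORM SYMBOL**: `kerReLim μ ν a b x = Re (2π)^{−(d+1)} ∫_{BZ} GsymInf … e^{ip·x} dp`
(the real Brillouin zone lies in `Strip (d+1) 0`, where PART 2's identification holds pointwise). [our object] -/
theorem kerReLim_eq_closed (μ ν a b : Fin (d + 1)) (x : Fin (d + 1) → ℤ) :
    kerReLim μ ν a b x = (latticeKernel (GsymInf μ ν a b) x).re := by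
  unfold kerReLim latticeKernel fourierBox
  congr 2
  refine setIntegral_congr_fun measurableSet_Icc fun q hq => ?_
  unfold integrand
  rw [GsymLim_eq_GsymInf le_rfl (kappa166_pos (d + 1)).le (ofRealVec_mem_Strip le_rfl hq)]

/-- **THE PERFECT EFFECTIVE LAPLACIAN `Δ_∞` IN CLOSED FORM**: the bond combination (1.66) of the lattice kernels of `GsymInf`. [our object] -/
theorem deltaZLim_eq_closed (p q : K (d + 1) (d + 1)) :
    deltaZLim (d := d) p q = ∑ μ : Fin (d + 1), ∑ ν : Fin (d + 1),
      if μ = ν then 0 else summand (fun a b x => (latticeKernel (GsymInf μ ν a b) x).re) μ ν p.2 q.2 (p.1 - q.1) := by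
  unfold deltaZLim
  refine Finset.sum_congr rfl fun μ _ => Finset.sum_congr rfl fun ν _ => ?_
  split_ifs with h
  · rfl
  · congr 1
    funext a b x
    exact kerReLim_eq_closed μ ν a b x

/-- **THE MULTIPLIER BLOCK OF THE PERFECT `m`-FOLD RESOLVENT IN CLOSED FORM** (`d = 3`, `2 ≤ Lc`, every `m`): at coarse points `x′ = Lc^m•u`, `y′ = Lc^m•u′`,
`KPerf Lc (sfStep Lc) (smStep 3 Lc) m x′ y′ (inr κ) (inr l) = (2/Lc^{8m}) · Δ_∞((u,κ),(u′,l))` with `Δ_∞` the explicit bond combination of the lattice kernels of the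
CLOSED-FORM symbol `GsymInf` (off the coarse points the block vanishes, `PerfectSymbolKMultiplier.KPerf_inr_inr_off`).  gan24-p3-g12's N0b-K-mm (named limit) +
PART 2 (closed form). [our object] -/
theorem KPerf_inr_inr_coarse_closed {Lc : ℕ} [NeZero Lc] (hLc : 2 ≤ Lc) (m : ℕ) (u u' : Fin (3 + 1) → ℤ) (κ l : Fin (3 + 1)) :
    KPerf (d := 3) Lc (sfStep Lc) (smStep 3 Lc) m (((Lc ^ m : ℕ) : ℤ) • u) (((Lc ^ m : ℕ) : ℤ) • u') (Sum.inr κ) (Sum.inr l) =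
      (2 * ((((Lc : ℝ) ^ m) ^ 8)⁻¹)) * ∑ μ : Fin (3 + 1), ∑ ν : Fin (3 + 1),
        if μ = ν then 0 else summand (fun a b x => (latticeKernel (GsymInf μ ν a b) x).re) μ ν κ l (u - u') := by
  rw [KPerf_inr_inr_coarse hLc m u u' κ l, deltaZLim_eq_closed]

end Summit.QuantumFields.BalabanUV.Beta.FP.PerfectSymbolKMultiplierClosed

end
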